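import Summits.BirchSwinnertonDyer.BirchSwinnertonDyer.Theorems.ByReductionTypeAtTwoRankOneAtTwoBigImageOddLocalOneDoorSubsliceSplit
import Summits.BirchSwinnertonDyer.BirchSwinnertonDyer.Theorems.GenusKolyvaginAtTwoGenusPrimitiveSupplyAtTwoTranspositionSelmerTrivialTwin
import Summits.BirchSwinnertonDyer.BirchSwinnertonDyer.Theorems.TwoAdicConverseFrobeniusParityNonsquareDiscriminant
import Summits.BirchSwinnertonDyer.Rank1Residual.F1Sign2.NegDiscDoorValueSupplyAtTwo
import HarnessLib

/-!
# Route ByReductionTypeAtTwo, crux `RankOneAtTwoBigImageOddLocal` (stmt-BirchSwinnertonDyer-23715), LINE v8.14 `one_door_analytic`: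
# ON THE CLASS `Δ_W < 0`, `Ш(W)[2] = 0` THE RESIDUE IS KOLYVAGIN NON-DIVISIBILITY AT A `Sel₂`-TRIVIAL PRIME DOOR

Lead prover seat `bsd-line-fkl-p1` g15 (2026-08-28), `--supports stmt-BirchSwinnertonDyer-23715` (helper).  THEOREMS ONLY; no definition, no named
fact introduced, no `sorry`; the `BSD₂` statements are CONDITIONAL on PRINT named facts of the tree (Gross–Zagier, Kolyvagin, modularity,
Hoffstein–Luo, Gross 1991 Prop. 3.7 (2)), on the route's four rank-`0` cruxes BY NAME, and on the conjecture-grade statement R⁻₀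
`HeegnerNonDivisibilityAtSelmerTrivialPrimeDoorAtTwo` (`Theorems/…OneDoorLawSubsliceDefs.lean` APPEND #9).  BSD is not proved by any of this.

* §1 transposition-admissible doors are MINIMAL doors (door-admissible by the tree's `ANg16.doorAdmissible_of_transpAdmissible`): `transpCount_eq_one_of_transpAdmissible`
  (the primes of odd trace have `(Δ/q) = 1` — `TwoAdicTwistConverse.legendreSym_discr_eq_one_of_odd_frobeniusTrace`),
  `identCount_eq_zero_of_transpAdmissible`, `minimal_of_transpAdmissible`.
* §2 a non-`2`-divisible Heegner point OPENS its door: `twist_entireLFunction_ne_zero_of_hasTwoDivisibilityUpToTorsion_zero` — `P ∉ 2E(K) + E(K)_tors`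
  ⟹ `P` non-torsion ⟹ `L'(E/K,1) ≠ 0` (Gross–Zagier) ⟹ `L(W^{(d_K)},1) ≠ 0` (`L'(E/K,1) = L'(E,1)·L(W^{(d_K)},1)`, modularity).  NO `2`-converse.
* §3 `hasBottomRungDoorAtTwo_of_heegnerNonDivisibility` — on {`Δ_W < 0`, `Ш(W)[2] = 0`, an odd-constant datum exists} R⁻₀ and the width seat
  gk2-p4's UNCONDITIONAL supply `GenusKolyTransp.exists_transpAdmissible_door_twistSelmerTwoCard_eq_one` produce a bottom-rung door datum; hence
  **`bsdp_two_of_heegnerNonDivisibility_negDisc`**: PRINT⁵ + the four rank-`0` cruxes + R⁻₀ ⟹ `BSDp W 2` for every such `W` of the slice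
  (`bsdp_two_of_hasLawfulDoorAtTwo_of_rankZero_cruxes ∘ hasLawfulDoorAtTwo_of_hasBottomRungDoorAtTwo_of_print`), and `…_of_manin` with the
  odd-constant datum from `S_manin`.
* §4 THE COMPOSITION of skeleton v8.15: `rankOneAtTwoBigImageOddLocal_of_heegnerNonDivisibility_of_residuePlus` — PRINT⁵ + R⁻₀ + R₊
  (`DoorIndexLawFullCAtTwoSomeDoorResiduePlus`, APPEND #10: the residue off the R⁻₀ class) + the four rank-`0` cruxes ⟹ the crux BY NAME
  (`doorIndexLawFullCAtTwoSomeDoorOffSubslice_of_heegnerNonDivisibility_of_residuePlus`, then v8.14's composition).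

So the `Δ_W < 0`, `Ш(W)[2] = 0` part of v8.14's residue `DoorIndexLawFullCAtTwoSomeDoorOffSubslice` is W. Zhang's theorem (Kolyvagin's conjecture,
Camb. J. Math. 2014, `p ≥ 5` in print) at `p = 2` in its simplest instance — an `L`-free, Selmer-theoretic statement.

References: [Zhang2014CJM] Thm. 1.1; [GrossLMS1991] §§2–3, §10; [Kolyvagin1990] Thm. A; [GrossZagier1986] Thm. I.6.3, V.§2; [MazurRubin2010]
Prop. 3.3, Cor. 3.4 (i); [Kramer1981] Prop. 3; [SilvermanAEC2009] V.2.3.1.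
-/

set_option autoImplicit false
-- the Theorems namespace of this sub repeats the summit name by design (D-0017 nested layout)
set_option linter.dupNamespace false

noncomputable section

open scoped Classical

namespace Summit.BirchSwinnertonDyer.BirchSwinnertonDyer.Theorems.RankOneAtTwoOneDoor

open WeierstrassCurve NumberField Literature.NumberTheory.EllipticCurves Literature.NumberTheory.EllipticCurves.ModularForms
  Summit.BirchSwinnertonDyer.Rank1Residual.F1Sign2
  Summit.BirchSwinnertonDyer.Rank1Residual.F1Sign2.TranspositionDoor
  Summit.BirchSwinnertonDyer.BirchSwinnertonDyer.Theses.ByReductionTypeAtTwo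

/-! ### §1 Transposition-admissible doors are minimal doors -/

/-! Transposition-admissible ⟹ door-admissible is the tree's `ANg16.doorAdmissible_of_transpAdmissible`
(`Rank1Residual/F1Sign2/NegDiscDoorValueSupplyAtTwo.lean`, -ty g12), consumed BY NAME below. -/

/-- **A transposition-admissible door has exactly ONE transposition prime**: `q₀` has `(Δ/q₀) = −1`, and every other prime of `d` has odd
trace, hence `(Δ/q) = 1` (Frobenius a `3`-cycle: `TwoAdicTwistConverse.legendreSym_discr_eq_one_of_odd_frobeniusTrace`). [cite: SilvermanAEC2009, V.2.3.1]
[cite: Kramer1981, Prop. 3] -/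
theorem transpCount_eq_one_of_transpAdmissible (W : WeierstrassCurve ℚ) [W.IsElliptic] [W.IsGloballyMinimal] {d : ℤ} {q₀ : ℕ}
    (h : TranspAdmissible W d q₀) : transpCount W d = 1 := by
  obtain ⟨hdneg, -, hd8, hq₀, hq₀d, hjac, hprimes, -⟩ := h
  have hd0 : d.natAbs ≠ 0 := Int.natAbs_ne_zero.mpr hdneg.ne
  unfold transpCount
  rw [Finset.card_eq_one]
  refine ⟨q₀, Finset.eq_singleton_iff_unique_mem.mpr ⟨?_, ?_⟩⟩
  · exact Finset.mem_filter.mpr ⟨Nat.mem_primeFactors.mpr ⟨hq₀, Int.ofNat_dvd_left.mp hq₀d, hd0⟩, hjac⟩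
  · intro q hq
    obtain ⟨hqpf, hjq⟩ := Finset.mem_filter.mp hq
    obtain ⟨hqp, hqdn, -⟩ := Nat.mem_primeFactors.mp hqpf
    have hqd : (q : ℤ) ∣ d := Int.ofNat_dvd_left.mpr hqdn
    by_contra hne
    -- `q ≠ q₀`: odd trace, hence `(Δ/q) = 1`, contradicting `(Δ/q) = −1`
    obtain ⟨hgood, hodd⟩ := hprimes q hqp hqd
    have hq2 : q ≠ 2 := by
      rintro rfl
      have h2d : (2 : ℤ) ∣ d := by exact_mod_cast hqd
      omega
    haveI : Fact q.Prime := ⟨hqp⟩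
    have hleg := Summit.BirchSwinnertonDyer.BirchSwinnertonDyer.Theorems.TwoAdicTwistConverse.legendreSym_discr_eq_one_of_odd_frobeniusTrace
      W q hq2 (hgood ⟨hqp⟩) (hodd hne)
    have hnum : W.Δ.num = minimalDiscriminantInt W := by rw [← cast_minimalDiscriminantInt W, Rat.num_intCast]
    rw [jacobiSym.legendreSym.to_jacobiSym, ← hnum] at hleg
    rw [hleg] at hjq
    exact absurd hjq (by decide)

/-- **A transposition-admissible door has NO identity prime**: `q₀` has `(Δ/q₀) = −1 ≠ 1`, every other prime of `d` has odd trace.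
[cite: Kramer1981, Prop. 3] -/
theorem identCount_eq_zero_of_transpAdmissible (W : WeierstrassCurve ℚ) [W.IsGloballyMinimal] {d : ℤ} {q₀ : ℕ}
    (h : TranspAdmissible W d q₀) : identCount W d = 0 := by
  obtain ⟨-, -, -, -, -, hjac, hprimes, -⟩ := h
  unfold identCount
  rw [Finset.card_eq_zero, Finset.filter_eq_empty_iff]
  intro q hqpf ⟨hj1, heven⟩
  obtain ⟨hqp, hqdn, -⟩ := Nat.mem_primeFactors.mp hqpf
  have hqd : (q : ℤ) ∣ d := Int.ofNat_dvd_left.mpr hqdn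
  by_cases hq : q = q₀
  · subst hq
    rw [hjac] at hj1
    exact absurd hj1 (by decide)
  · exact (Int.not_odd_iff_even.mpr heven) ((hprimes q hqp hqd).2 hq)

/-- **A transposition-admissible door of a `Δ_W < 0` curve is MINIMAL**: `t + 2s = 1 = [Δ_W < 0]`. [cite: Kramer1981, Prop. 3] [cite: GrossLMS1991, §10] -/
theorem minimal_of_transpAdmissible (W : WeierstrassCurve ℚ) [W.IsElliptic] [W.IsGloballyMinimal] {d : ℤ} {q₀ : ℕ}
    (h : TranspAdmissible W d q₀) (hΔ : W.Δ < 0) :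
    transpCount W d + 2 * identCount W d = (if W.Δ < 0 then 1 else 0) := by
  rw [transpCount_eq_one_of_transpAdmissible W h, identCount_eq_zero_of_transpAdmissible W h, if_pos hΔ]

/-! ### §2 A non-`2`-divisible Heegner point opens its door (Gross–Zagier; no `2`-converse) -/

/-- **`P ∉ 2E(K) + E(K)_tors ⟹ L(W^{(d_K)}, 1) ≠ 0`** for a Heegner point `P` of a curve of analytic rank `1`: `P` has infinite order
(`not_isOfFinAddOrder_of_hasTwoDivisibilityUpToTorsion_zero`), so `L'(E/K,1) ≠ 0` by Gross–Zagier (`lDerivEK_ne_zero_iff_not_isOfFinAddOrder`), and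
`L'(E/K,1) = L'(E,1)·L(W^{(d_K)},1)` (modularity: `lDerivEK_eq_deriv_mul_of_entireLFunction_one_eq_zero`).  CONDITIONAL on the named facts
`gross_zagier` (at `(N_W, W, K)`) and `exists_isNewformOf`. [cite: GrossZagier1986, Thm. I.6.3 and V.§2] -/
theorem twist_entireLFunction_ne_zero_of_hasTwoDivisibilityUpToTorsion_zero (hnf : exists_isNewformOf)
    (W : WeierstrassCurve ℚ) [W.IsElliptic] [W.IsGloballyMinimal] [NeZero (W.conductorNorm ℤ)] (hr : W.analyticRank = 1)
    (K : Type) [Field K] [NumberField K] (hK : IsImaginaryQuadratic K) (hGZ : gross_zagier (W.conductorNorm ℤ) W K)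
    (hHN : SatisfiesHeegnerHypothesis (W.conductorNorm ℤ) K)
    (Dt : ModularParametrizationData W (W.conductorNorm ℤ)) (H : HeegnerDatum (W.conductorNorm ℤ) (NumberField.discr K))
    (ι : K →+* ℂ) (P : (W.baseChange K).toAffine.Point)
    (hP : WeierstrassCurve.Affine.Point.map ι.toRatAlgHom P = heegnerPointComplex Dt H)
    (hm0 : HasTwoDivisibilityUpToTorsion W K P 0) :
    (W.quadraticTwist (NumberField.discr K : ℚ)).entireLFunction 1 ≠ 0 := by
  have hmod : hasEntireLFunction_rat := hasEntireLFunction_rat_of_exists_isNewformOf hnf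
  have hPinf : ¬ IsOfFinAddOrder P := not_isOfFinAddOrder_of_hasTwoDivisibilityUpToTorsion_zero W K P hm0
  have hPH : IsHeegnerPoint (W.conductorNorm ℤ) W K P := ⟨Dt, H, ι, hP⟩
  have hLK : LDerivEK W K ≠ 0 := (lDerivEK_ne_zero_iff_not_isOfFinAddOrder W (W.conductorNorm ℤ) K hGZ hK hHN hPH).mpr hPinf
  have hL0 : W.entireLFunction 1 = 0 := entireLFunction_one_eq_zero_of_analyticRank_eq_one hr
  rw [lDerivEK_eq_deriv_mul_of_entireLFunction_one_eq_zero hmod W K hL0] at hLK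
  exact (mul_ne_zero_iff.mp hLK).2

/-! ### §3 On `{Δ_W < 0, Ш(W)[2] = 0}`: R⁻₀ ⟹ a bottom-rung door ⟹ `BSD₂(W)` -/

/-- **R⁻₀ and gk2-p4's supply give a BOTTOM-RUNG DOOR DATUM** for every `W` of the slice with `Δ_W < 0`, `Ш(W)[2] = 0` and an odd-constant
parametrisation datum: the supply (`GenusKolyTransp.exists_transpAdmissible_door_twistSelmerTwoCard_eq_one`, unconditional; `rank E(ℚ) = 1` from the four
primary printed facts) gives `K`, `q₀` with `(d_K, q₀)` transposition-admissible — hence door-admissible (`ANg16.doorAdmissible_of_transpAdmissible`) and minimal (§1) —, the door open at `q₀`,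
`(d_K, N_W) = 1`, the Heegner hypothesis and `#Sel₂(W^{(d_K)}) = 1`; over the odd-constant datum the `K`-rational Heegner point exists
(`heegnerPointComplex_mem_range_map_holds`); R⁻₀ says it is not `2`-divisible modulo torsion; §2 opens the door (`L(W^{(d_K)},1) ≠ 0`); a globally
minimal model of the twist exists.  CONDITIONAL on Gross–Zagier, Kolyvagin, modularity, Hoffstein–Luo (rank one) and on R⁻₀.
[cite: Zhang2014CJM, Thm. 1.1] [cite: MazurRubin2010, Prop. 3.3 and Cor. 3.4 (i)] [cite: GrossZagier1986, Thm. I.6.3 and V.§2] -/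
theorem hasBottomRungDoorAtTwo_of_heegnerNonDivisibility
    (hGZ : ∀ (N : ℕ) [NeZero N] (W : WeierstrassCurve ℚ) (K : Type) [Field K] [NumberField K], gross_zagier N W K)
    (hKo : ∀ (N : ℕ) [NeZero N] (W : WeierstrassCurve ℚ) (K : Type) [Field K] [NumberField K], kolyvagin N W K)
    (hnf : exists_isNewformOf) (hHL : HoffsteinLuo1997_exists_twist_L_one_ne_zero)
    (hR : HeegnerNonDivisibilityAtSelmerTrivialPrimeDoorAtTwo)
    (W : WeierstrassCurve ℚ) [W.IsElliptic] [W.IsGloballyMinimal] [NeZero (W.conductorNorm ℤ)]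
    (hCM : ¬ W.HasCM) (hsurj : ∀ n : ℕ, W.HasSurjectiveModNGaloisRep ((2 ^ n : ℕ) : ℤ)) (hT : Odd W.torsionOrder)
    (hc : Odd W.tamagawaProduct) (hr : W.analyticRank = 1) (hΔ : W.Δ < 0) (hSha : ShaTwoTrivial W)
    (Dt : ModularParametrizationData W (W.conductorNorm ℤ)) (hodd : Odd Dt.c) : HasBottomRungDoorAtTwo W := by
  have hT2 : NoRationalTwoTorsion W := noRationalTwoTorsion_of_odd_torsionOrder W hT
  have hrk : W.mordellWeilRank = 1 :=
    (mordellWeilRank_eq_one_of_analyticRank_eq_one_of_isGloballyMinimal hGZ hKo hnf hHL W hr).1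
  -- the supply: a transposition-admissible prime door with trivial twin `Sel₂`
  obtain ⟨K, iF, iN, q₀, iq, hK, htr, hnn, hcop, hHN, hsel⟩ :=
    Summit.BirchSwinnertonDyer.BirchSwinnertonDyer.Theorems.GenusKolyTransp.exists_transpAdmissible_door_twistSelmerTwoCard_eq_one
      W hΔ hT2 hrk hSha
  have hadm : DoorAdmissible W (NumberField.discr K) := ANg16.doorAdmissible_of_transpAdmissible W htr
  have hmin : transpCount W (NumberField.discr K) + 2 * identCount W (NumberField.discr K) = (if W.Δ < 0 then 1 else 0) :=
    minimal_of_transpAdmissible W htr hΔ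
  -- the Heegner datum over `K` and the `K`-rational Heegner point over the odd-constant parametrisation datum
  obtain ⟨H, -⟩ :=
    nonempty_heegnerDatum_holds (W.conductorNorm ℤ) K hK (exists_dvd_sq_sub_discr_holds (W.conductorNorm ℤ) K hK hHN).choose_spec
  obtain ⟨ι⟩ : Nonempty (K →+* ℂ) := inferInstance
  obtain ⟨P, hP⟩ := heegnerPointComplex_mem_range_map_holds (W.conductorNorm ℤ) W K hK hHN Dt H ι
  -- R⁻₀: the Heegner point is not `2`-divisible modulo torsion
  have hm0 : HasTwoDivisibilityUpToTorsion W K P 0 :=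
    hR W hCM hsurj hT hc hr hΔ hSha K hK q₀ htr hnn hcop hHN hsel Dt H ι P hP hodd
  -- hence the door is open: `L(W^{(d_K)}, 1) ≠ 0`
  have hLt : (W.quadraticTwist (NumberField.discr K : ℚ)).entireLFunction 1 ≠ 0 :=
    twist_entireLFunction_ne_zero_of_hasTwoDivisibilityUpToTorsion_zero hnf W hr K hK (hGZ _ W K) hHN Dt H ι P hP hm0
  -- a globally minimal model of the twist
  have hD0 : (NumberField.discr K : ℚ) ≠ 0 := by exact_mod_cast NumberField.discr_ne_zero K
  haveI hEt : (W.quadraticTwist (NumberField.discr K : ℚ)).IsElliptic := W.isElliptic_quadraticTwist hD0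
  obtain ⟨Cd, hCd⟩ := hasGlobalMinimalModel_rat_holds (W.quadraticTwist (NumberField.discr K : ℚ))
  unfold HasBottomRungDoorAtTwo
  exact ⟨K, iF, iN, hK, hadm, hLt, hmin, Dt, H, ι, P, Cd • W.quadraticTwist (NumberField.discr K : ℚ), inferInstance, hCd, Cd, hP, rfl,
    hodd, hm0⟩

/-- **`BSDp W 2` ON THE CLASS `{Δ_W < 0, Ш(W)[2] = 0}` FROM R⁻₀**, modulo the five printed facts (Gross–Zagier, Kolyvagin, modularity, Hoffstein–Luo,
Gross 1991 Prop. 3.7 (2)) and the route's four rank-`0` cruxes at `2` BY NAME: for `W/ℚ` globally minimal, non-CM, `ρ_{W,2^n}` onto for all `n`, odd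
torsion order, odd Tamagawa product, analytic rank `1`, `Δ_W < 0`, `Ш(W)[2] = 0`, and a parametrisation datum of level `N_W` with odd constant, R⁻₀
yields a bottom-rung door datum (`hasBottomRungDoorAtTwo_of_heegnerNonDivisibility`), which the bottom rung U₀ from print makes lawful
(`hasLawfulDoorAtTwo_of_hasBottomRungDoorAtTwo_of_print`), whence `BSDp W 2` (`bsdp_two_of_hasLawfulDoorAtTwo_of_rankZero_cruxes`).  So on this class the
residue of LINE v8.14 IS Kolyvagin non-divisibility at `2` — W. Zhang's theorem at `p = 2`.  CONDITIONAL by design; BSD is not proved by this.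
[cite: Zhang2014CJM, Thm. 1.1] [cite: GrossLMS1991, §10 and Prop. 3.7 (2)] [cite: Kolyvagin1990, Thm. A] [cite: GrossZagier1986, Thm. I.6.3 and V.§2] -/
theorem bsdp_two_of_heegnerNonDivisibility_negDisc
    (hGZ : ∀ (N : ℕ) [NeZero N] (W : WeierstrassCurve ℚ) (K : Type) [Field K] [NumberField K], gross_zagier N W K)
    (hKo : ∀ (N : ℕ) [NeZero N] (W : WeierstrassCurve ℚ) (K : Type) [Field K] [NumberField K], kolyvagin N W K)
    (hnf : exists_isNewformOf) (hHL : HoffsteinLuo1997_exists_twist_L_one_ne_zero)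
    (h37 : Literature.NumberTheory.EllipticCurves.GrossLMS1991.prop37_2_frobeniusCongruence)
    (hZ4 : GoodOrdinaryRankZeroAtTwo ∧ MultiplicativeRankZeroAtTwo ∧ SupersingularRankZeroAtTwo ∧ AdditiveRankZeroAtTwo)
    (hR : HeegnerNonDivisibilityAtSelmerTrivialPrimeDoorAtTwo)
    (W : WeierstrassCurve ℚ) [W.IsElliptic] [W.IsGloballyMinimal] [NeZero (W.conductorNorm ℤ)]
    (hCM : ¬ W.HasCM) (hsurj : ∀ n : ℕ, W.HasSurjectiveModNGaloisRep ((2 ^ n : ℕ) : ℤ)) (hT : Odd W.torsionOrder)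
    (hc : Odd W.tamagawaProduct) (hr : W.analyticRank = 1) (hΔ : W.Δ < 0) (hSha : ShaTwoTrivial W)
    (hDt : ∃ Dt : ModularParametrizationData W (W.conductorNorm ℤ), Odd Dt.c) : BSDp W 2 := by
  obtain ⟨Dt, hodd⟩ := hDt
  exact bsdp_two_of_hasLawfulDoorAtTwo_of_rankZero_cruxes hGZ hKo hnf hHL hZ4 W hCM hT hc hr
    (hasLawfulDoorAtTwo_of_hasBottomRungDoorAtTwo_of_print hGZ hKo hnf hHL h37 W hCM hsurj hT hc hr
      (hasBottomRungDoorAtTwo_of_heegnerNonDivisibility hGZ hKo hnf hHL hR W hCM hsurj hT hc hr hΔ hSha Dt hodd))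

/-- **The same with the odd-constant datum supplied by `S_manin`** (an odd-constant parametrisation datum for every curve with `E(ℚ)[2] = 0`:
PRINT at `4 ∤ N` by Abbes–Ullmo / Česnavičius, the `2`-primary Manin question at `4 ∣ N` — `RankOneAtTwoOneDoor.s_manin_of`).  CONDITIONAL by design;
BSD is not proved by this. [cite: Zhang2014CJM, Thm. 1.1] [cite: Cesnavicius2018, Thm. 1.2] [cite: GrossLMS1991, §10] -/
theorem bsdp_two_of_heegnerNonDivisibility_negDisc_of_manin
    (hGZ : ∀ (N : ℕ) [NeZero N] (W : WeierstrassCurve ℚ) (K : Type) [Field K] [NumberField K], gross_zagier N W K)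
    (hKo : ∀ (N : ℕ) [NeZero N] (W : WeierstrassCurve ℚ) (K : Type) [Field K] [NumberField K], kolyvagin N W K)
    (hnf : exists_isNewformOf) (hHL : HoffsteinLuo1997_exists_twist_L_one_ne_zero)
    (h37 : Literature.NumberTheory.EllipticCurves.GrossLMS1991.prop37_2_frobeniusCongruence)
    (hZ4 : GoodOrdinaryRankZeroAtTwo ∧ MultiplicativeRankZeroAtTwo ∧ SupersingularRankZeroAtTwo ∧ AdditiveRankZeroAtTwo)
    (hR : HeegnerNonDivisibilityAtSelmerTrivialPrimeDoorAtTwo) (hMan : S_manin)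
    (W : WeierstrassCurve ℚ) [W.IsElliptic] [W.IsGloballyMinimal] [NeZero (W.conductorNorm ℤ)]
    (hCM : ¬ W.HasCM) (hsurj : ∀ n : ℕ, W.HasSurjectiveModNGaloisRep ((2 ^ n : ℕ) : ℤ)) (hT : Odd W.torsionOrder)
    (hc : Odd W.tamagawaProduct) (hr : W.analyticRank = 1) (hΔ : W.Δ < 0) (hSha : ShaTwoTrivial W) : BSDp W 2 := by
  obtain ⟨Dt, hc2⟩ := hMan W (noRationalTwoTorsion_of_odd_torsionOrder W hT)
  exact bsdp_two_of_heegnerNonDivisibility_negDisc hGZ hKo hnf hHL h37 hZ4 hR W hCM hsurj hT hc hr hΔ hSha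
    ⟨Dt, Int.not_even_iff_odd.mp fun h => hc2 (even_iff_two_dvd.mp h)⟩

/-! ### §4 The composition of skeleton v8.15: the residue split into R⁻₀ and R₊ -/

/-- **The R⁻₀ class lies in the sub-slice**: under R⁻₀ (and the four primary printed facts) every curve of the slice with `Δ_W < 0`, `Ш(W)[2] = 0` and an
odd-constant datum has a bottom-rung door datum — the `hcls` input of `doorIndexLawFullCAtTwoSomeDoorOffSubslice_of_residuePlus_of_class`.
CONDITIONAL by design. [cite: Zhang2014CJM, Thm. 1.1] [cite: MazurRubin2010, Prop. 3.3 and Cor. 3.4 (i)] -/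
theorem class_hasBottomRungDoorAtTwo_of_heegnerNonDivisibility
    (hGZ : ∀ (N : ℕ) [NeZero N] (W : WeierstrassCurve ℚ) (K : Type) [Field K] [NumberField K], gross_zagier N W K)
    (hKo : ∀ (N : ℕ) [NeZero N] (W : WeierstrassCurve ℚ) (K : Type) [Field K] [NumberField K], kolyvagin N W K)
    (hnf : exists_isNewformOf) (hHL : HoffsteinLuo1997_exists_twist_L_one_ne_zero)
    (hR : HeegnerNonDivisibilityAtSelmerTrivialPrimeDoorAtTwo) :
    ∀ (W : WeierstrassCurve ℚ) [W.IsElliptic] [W.IsGloballyMinimal] [NeZero (W.conductorNorm ℤ)],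
      ¬ W.HasCM → (∀ n : ℕ, W.HasSurjectiveModNGaloisRep ((2 ^ n : ℕ) : ℤ)) → Odd W.torsionOrder → Odd W.tamagawaProduct →
      W.analyticRank = 1 → W.Δ < 0 → ShaTwoTrivial W →
      ∀ Dt : ModularParametrizationData W (W.conductorNorm ℤ), Odd Dt.c → HasBottomRungDoorAtTwo W :=
  fun W _ _ _ hCM hsurj hT hc hr hΔ hSha Dt hodd =>
    hasBottomRungDoorAtTwo_of_heegnerNonDivisibility hGZ hKo hnf hHL hR W hCM hsurj hT hc hr hΔ hSha Dt hodd

/-- **R⁻₀ ∧ R₊ ⟹ v8.14's residue** (modulo the four primary printed facts): on the class R⁻₀ puts the curve IN the sub-slice, so the residue's hypothesis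
`¬ HasBottomRungDoorAtTwo W` is contradictory there; off the class R₊ is the residue.  CONDITIONAL by design. [cite: GrossLMS1991, Conj. 1.2, §3 and §10]
[cite: Zhang2014CJM, Thm. 1.1] -/
theorem doorIndexLawFullCAtTwoSomeDoorOffSubslice_of_heegnerNonDivisibility_of_residuePlus
    (hGZ : ∀ (N : ℕ) [NeZero N] (W : WeierstrassCurve ℚ) (K : Type) [Field K] [NumberField K], gross_zagier N W K)
    (hKo : ∀ (N : ℕ) [NeZero N] (W : WeierstrassCurve ℚ) (K : Type) [Field K] [NumberField K], kolyvagin N W K)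
    (hnf : exists_isNewformOf) (hHL : HoffsteinLuo1997_exists_twist_L_one_ne_zero)
    (hR : HeegnerNonDivisibilityAtSelmerTrivialPrimeDoorAtTwo) (hP : DoorIndexLawFullCAtTwoSomeDoorResiduePlus) :
    DoorIndexLawFullCAtTwoSomeDoorOffSubslice :=
  doorIndexLawFullCAtTwoSomeDoorOffSubslice_of_residuePlus_of_class hP
    (class_hasBottomRungDoorAtTwo_of_heegnerNonDivisibility hGZ hKo hnf hHL hR)

/-- **THE CRUX `RankOneAtTwoBigImageOddLocal` BY NAME FROM LINE v8.15's INPUTS**: the five printed facts (Gross–Zagier, Kolyvagin, modularity, Hoffstein–Luo,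
Gross 1991 Prop. 3.7 (2)); the TWO conjecture-grade residues R⁻₀ `HeegnerNonDivisibilityAtSelmerTrivialPrimeDoorAtTwo` (Kolyvagin's conjecture at `2` at a
`Sel₂`-trivial prime door) and R₊ `DoorIndexLawFullCAtTwoSomeDoorResiduePlus` (the residue off that class); and the route's four rank-`0` cruxes at `2` BY
NAME — through v8.14's `rankOneAtTwoBigImageOddLocal_of_someDoorOffSubslice`.  BSD is not proved by this: conditional by design.
[cite: GrossLMS1991, §10 and Conj. 1.2] [cite: Zhang2014CJM, Thm. 1.1] [cite: Kolyvagin1990, Thm. A] [cite: GrossZagier1986, Thm. I.6.3 and V.§2] -/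
theorem rankOneAtTwoBigImageOddLocal_of_heegnerNonDivisibility_of_residuePlus
    (hGZ : ∀ (N : ℕ) [NeZero N] (W : WeierstrassCurve ℚ) (K : Type) [Field K] [NumberField K], gross_zagier N W K)
    (hKo : ∀ (N : ℕ) [NeZero N] (W : WeierstrassCurve ℚ) (K : Type) [Field K] [NumberField K], kolyvagin N W K)
    (hnf : exists_isNewformOf) (hHL : HoffsteinLuo1997_exists_twist_L_one_ne_zero)
    (h37 : Literature.NumberTheory.EllipticCurves.GrossLMS1991.prop37_2_frobeniusCongruence)
    (hR : HeegnerNonDivisibilityAtSelmerTrivialPrimeDoorAtTwo) (hP : DoorIndexLawFullCAtTwoSomeDoorResiduePlus)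
    (hZ4 : GoodOrdinaryRankZeroAtTwo ∧ MultiplicativeRankZeroAtTwo ∧ SupersingularRankZeroAtTwo ∧ AdditiveRankZeroAtTwo) :
    RankOneAtTwoBigImageOddLocal :=
  rankOneAtTwoBigImageOddLocal_of_someDoorOffSubslice hGZ hKo hnf hHL h37
    (doorIndexLawFullCAtTwoSomeDoorOffSubslice_of_heegnerNonDivisibility_of_residuePlus hGZ hKo hnf hHL hR hP) hZ4

end Summit.BirchSwinnertonDyer.BirchSwinnertonDyer.Theorems.RankOneAtTwoOneDoor

end
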